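import Literature.AnabelianGeometry.SemiGraphs.TemperedAnabelianLem63iiiProofs
import Literature.AnabelianGeometry.SemiGraphs.TemperedAnabelianTowerWitness
import Literature.AnabelianGeometry.SemiGraphs.TemperedProfiniteProducts
import Literature.AnabelianGeometry.SemiGraphs.ProfiniteCompletionModel
import Literature.AnabelianGeometry.SemiGraphs.TemperedAnabelianThm64Sub
import Literature.AnabelianGeometry.SemiGraphs.TemperedOrigin
import Literature.AnabelianGeometry.AbsoluteAnabelian.ZHatCompletionAdicCompleteness
import Mathlib.FieldTheory.Galois.Profinite
import HarnessLib

/-!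
# The André-tower input of the [SemiAnbd] §6 closers is NECESSARY: a tempered datum of the §6
# interface violating Lemma 6.1 (iii), Lemma 6.3 (iii), T64-L06′ and Theorem 6.6

Mochizuki, *Semi-graphs of anabelioids*, Publ. RIMS **42** (2006) [SemiAnbd], §6, author's
manuscript pp. 69–72 (Lemma 6.1 (iii) "`N_{Π_{X_K}}(Π^temp_{X_K}) = Π^temp_{X_K}`", Lemma 6.3 (iii),
Theorem 6.6). [cite: MochizukiSemiAnbd2006, §6 pp.69-72]

NECESSITY / NO-HIDDEN-STRENGTH certificate (abc-iut cell, prover abc-iut-w5-d240; proof-only, no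
definitions), companion of `TemperedAnabelianTowerWitness(Curve).lean` (satisfiability of the tower
input).  The in-tree closers of [SemiAnbd] Lemma 6.1 (iii), Lemma 6.3 (ii)(iii), T64-L06′, Theorem 6.4
and Theorem 6.6 (`piTempNormallyTerminal_of_tower`, `piTempDenseDOFConjugator_of_tower`,
`openDenseDOFConjugator_of_tower`, `temperedAnabelianTheorem_of_tower`,
`profiniteOuterIsoLiftsHolds_of_tower`, and the [EtTh] Lem. 2.17 (ii) lane) are all stated modulo
`IsTempered Π^temp` AND the André-tower input `htower₀` (cofinal open normal `N ⊴ Π^temp` with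
`Π^temp/N ⊇` a non-abelian free normal subgroup of finite index and finite rank).  This file
kernel-checks that the second input cannot be dropped and that the corresponding frozen FACT rows are
admissible only origin-guarded (as hypotheses ON the origin certificate), never as closed statements:

* `exists_temperedCurve_isTempered_not_piTempNormallyTerminal`: the datum `X₁ : TemperedCurve p` with
  `K = ℚ_p`, `Π^temp := ℤ × G_{ℚ_p}` (`ℤ` discrete), augmentation the second projection,
  `Π := Ẑ × G_{ℚ_p}`, no closed points, satisfies every axiom of the interface and `IsTempered`, but
  the image of `Π^temp` in `Π` is a PROPER NORMAL subgroup (`Ẑ` is commutative, and `η(ℤ) ≠ Ẑ`: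
  the automorphism of `Ẑ ≅ ∏_p ℤ_p` multiplying the `2`-adic coordinate by `−1` moves `η(1)` off
  `η(ℤ)`), so `N_Π(Π^temp) = Π ≠ Π^temp`: `¬ X₁.PiTempNormallyTerminal` (the typed Lem. 6.1 (iii)),
  `¬ X₁.PiTempDenseDOFConjugator` (Lem. 6.3 (iii)), `¬ X₁.OpenDenseDOFConjugator` (T64-L06′),
  `¬ X₁.ProfiniteOuterIsoLifts X₁` (Thm. 6.6: that automorphism `× id_{G_{ℚ_p}}` of `Π` lies under
  no automorphism of `Π^temp`), and — by the tree's own closer — `X₁` violates `htower₀`;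
* hence the CLOSED universal forms are false over the interface:
  `not_forall_isTempered_piTempNormallyTerminal`, `not_forall_openDenseDOFConjugator`
  (F-2837 `OpenDenseDOFConjugator` must be bound per datum, as `temperedAnabelianTheorem_of_…` does),
  `not_forall_profiniteNormalizersHolds` (F-1706), `not_forall_denseSubgroupsHolds` (F-1705),
  `not_forall_profiniteOuterIsoLiftsHolds` (F-1707): these printed statements are typed over an
  UNINTERPRETED origin certificate `Ω : TemperedOrigin p`, and the certificate "every datum is a curve"
  makes them false — they are hypotheses ON `Ω`, never closed facts.

HONEST FRAMING: NOTHING in [SemiAnbd] is refuted.  The interface `TemperedCurve p` records only part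
of the structure of `π₁^temp` of a hyperbolic curve (for which print has the tower, [André] §4.5, and
the printed lemmas hold); `ℤ × G_{ℚ_p}` is not such a group.  The file says: the tower binder of the
cell's §6 closers is not idle, and the FACT rows F-1705, F-1706, F-1707, F-2837 are origin-guarded by
necessity.  Nothing here concerns the disputed parts of inter-universal Teichmüller theory or takes a
side on [IUTchIII] Cor. 3.12.
-/

noncomputable section

namespace Literature.AnabelianGeometry.SemiGraphs

open CategoryTheory ProfiniteGrp ProfiniteGrp.ProfiniteCompletion
open _root_.Topology
open scoped Pointwise

/-! ### An automorphism of `Ẑ` moving `η(1)` off `η(ℤ)` -/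

section ZHatAut

/-- The coordinates of `η(j)` under the tree's `Ẑ ≃ₜ* ∏_p ℤ_p` (normalised by `η(1) ↦ 1`) are the
diagonal `(j)_p`. [folklore] -/
private theorem toAdd_equiv_etaFn_ofAdd
    (e : completion (GrpCat.of (Multiplicative ℤ)) ≃ₜ*
      Multiplicative (∀ p : Nat.Primes, @PadicInt (p : ℕ) ⟨p.2⟩))
    (he : Multiplicative.toAdd
      (e (etaFn (GrpCat.of (Multiplicative ℤ)) (Multiplicative.ofAdd (1 : ℤ) : Multiplicative ℤ))) =
        1)
    (j : ℤ) (q : Nat.Primes) :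
    Multiplicative.toAdd
        (e (etaFn (GrpCat.of (Multiplicative ℤ)) (Multiplicative.ofAdd j : Multiplicative ℤ))) q =
      ((j : ℤ) : @PadicInt (q : ℕ) ⟨q.2⟩) := by
  rw [Literature.AnabelianGeometry.AbsoluteAnabelian.ZHatCompletion.etaFn_ofAdd j, map_zpow,
    toAdd_zpow, he, Pi.smul_apply, Pi.one_apply, zsmul_eq_mul, mul_one]

/-- `η : ℤ → Ẑ` is injective (seen in the `3`-adic coordinate). [folklore] -/
private theorem etaFn_int_injective :
    Function.Injective (etaFn (GrpCat.of (Multiplicative ℤ))) := by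
  obtain ⟨e, he⟩ :=
    Literature.AnabelianGeometry.AbsoluteAnabelian.ZHatCompletion.exists_continuousMulEquiv_padicProd
  intro a b hab
  have ha := toAdd_equiv_etaFn_ofAdd e he (Multiplicative.toAdd a) ⟨3, Nat.prime_three⟩
  have hb := toAdd_equiv_etaFn_ofAdd e he (Multiplicative.toAdd b) ⟨3, Nat.prime_three⟩
  have hab' : Multiplicative.toAdd (e (etaFn (GrpCat.of (Multiplicative ℤ)) a)) ⟨3, Nat.prime_three⟩ =
      Multiplicative.toAdd (e (etaFn (GrpCat.of (Multiplicative ℤ)) b)) ⟨3, Nat.prime_three⟩ := by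
    rw [hab]
  have h3 : ((Multiplicative.toAdd a : ℤ) : @PadicInt 3 ⟨Nat.prime_three⟩) =
      ((Multiplicative.toAdd b : ℤ) : @PadicInt 3 ⟨Nat.prime_three⟩) :=
    ha.symm.trans (hab'.trans hb)
  haveI : Fact (Nat.Prime 3) := ⟨Nat.prime_three⟩
  exact Multiplicative.toAdd.injective (Int.cast_injective h3)

/-- **`η(ℤ) ⊊ Ẑ`, witnessed by an automorphism**: there is an automorphism `α` of the topological group
`Ẑ` with `α(η(1)) ∉ η(ℤ)` — under `Ẑ ≅ ∏_p ℤ_p`, multiply by the unit `(−1 at 2, 1 elsewhere)`; the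
image of `η(1) = (1)_p` has coordinates `−1` at `2` and `1` at `3`, which is no diagonal `(j)_p`.
[folklore] -/
private theorem exists_continuousMulEquiv_etaFn_one_not_mem_range :
    ∃ α : completion (GrpCat.of (Multiplicative ℤ)) ≃ₜ* completion (GrpCat.of (Multiplicative ℤ)),
      α (etaFn (GrpCat.of (Multiplicative ℤ)) (Multiplicative.ofAdd (1 : ℤ) : Multiplicative ℤ)) ∉
        Set.range (etaFn (GrpCat.of (Multiplicative ℤ))) := by
  obtain ⟨e, he⟩ :=
    Literature.AnabelianGeometry.AbsoluteAnabelian.ZHatCompletion.exists_continuousMulEquiv_padicProd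
  -- the unit `v = (−1 at 2, 1 elsewhere)` of the ring `∏_p ℤ_p`
  obtain ⟨v₀, hv₀, hv2, hv3⟩ : ∃ v₀ : ∀ q : Nat.Primes, @PadicInt (q : ℕ) ⟨q.2⟩,
      v₀ * v₀ = 1 ∧ v₀ ⟨2, Nat.prime_two⟩ = -1 ∧ v₀ ⟨3, Nat.prime_three⟩ = 1 := by
    refine ⟨fun q => if (q : ℕ) = 2 then -1 else 1, ?_, ?_, ?_⟩
    · funext q
      simp only [Pi.mul_apply, Pi.one_apply]
      split_ifs <;> simp
    · simp
    · simp
  let v : (∀ q : Nat.Primes, @PadicInt (q : ℕ) ⟨q.2⟩)ˣ := Units.mkOfMulEqOne v₀ v₀ hv₀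
  obtain ⟨m, hm⟩ :=
    Literature.AnabelianGeometry.AbsoluteAnabelian.ZHatCompletion.exists_continuousMulEquiv_mulRight v
  refine ⟨e.trans (m.trans e.symm), ?_⟩
  rintro ⟨k, hk⟩
  -- transport the alleged equation `η k = e⁻¹ (m (e (η 1)))` to `∏_p ℤ_p`
  have hk' : e (etaFn (GrpCat.of (Multiplicative ℤ)) k) =
      m (e (etaFn (GrpCat.of (Multiplicative ℤ)) (Multiplicative.ofAdd (1 : ℤ) : Multiplicative ℤ))) := by
    rw [hk]
    change e (e.symm (m (e _))) = _
    exact e.apply_symm_apply _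
  have hR : Multiplicative.toAdd
      (m (e (etaFn (GrpCat.of (Multiplicative ℤ)) (Multiplicative.ofAdd (1 : ℤ) : Multiplicative ℤ)))) =
        v₀ := by
    rw [hm, he, one_mul]
    rfl
  -- coordinates of `η k` are the diagonal `(k)_p`; compare at `3` and at `2`
  have hcoord := toAdd_equiv_etaFn_ofAdd e he (Multiplicative.toAdd k)
  have hk3 := hcoord ⟨3, Nat.prime_three⟩
  have hk2 := hcoord ⟨2, Nat.prime_two⟩
  have hkv : Multiplicative.toAdd (e (etaFn (GrpCat.of (Multiplicative ℤ)) k)) = v₀ := by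
    rw [hk']; exact hR
  have h3 : ((Multiplicative.toAdd k : ℤ) : @PadicInt 3 ⟨Nat.prime_three⟩) = 1 :=
    hk3.symm.trans ((congrFun hkv ⟨3, Nat.prime_three⟩).trans hv3)
  have h2 : ((Multiplicative.toAdd k : ℤ) : @PadicInt 2 ⟨Nat.prime_two⟩) = -1 :=
    hk2.symm.trans ((congrFun hkv ⟨2, Nat.prime_two⟩).trans hv2)
  have hj1 : (Multiplicative.toAdd k : ℤ) = 1 := by
    haveI : Fact (Nat.Prime 3) := ⟨Nat.prime_three⟩
    have h3' : ((Multiplicative.toAdd k : ℤ) : ℤ_[3]) = ((1 : ℤ) : ℤ_[3]) := by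
      rw [Int.cast_one]; exact h3
    exact Int.cast_injective h3'
  rw [hj1, Int.cast_one] at h2
  haveI : Fact (Nat.Prime 2) := ⟨Nat.prime_two⟩
  have h20 : (2 : ℤ_[2]) = 0 := by linear_combination h2
  exact absurd h20 (by norm_num)

end ZHatAut

/-! ### The datum `X₁`: `Π^temp = ℤ × G_{ℚ_p}`, `Π = Ẑ × G_{ℚ_p}` -/

section Curve

variable (p : ℕ) [Fact p.Prime]

/-- **The André-tower input is necessary** ([SemiAnbd] §6 pp. 69–72 over the interface): there is a
datum `X₁ : TemperedCurve p` — `K = ℚ_p`, `Π^temp := ℤ × G_{ℚ_p}` (`ℤ` discrete), augmentation the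
second projection, `Π := Ẑ × G_{ℚ_p}`, no closed points — with `Π^temp` TEMPERED, whose image in `Π`
is a proper normal subgroup; consequently the typed Lemma 6.1 (iii) `PiTempNormallyTerminal`, Lemma
6.3 (iii) `PiTempDenseDOFConjugator`, T64-L06′ `OpenDenseDOFConjugator` and Theorem 6.6
`ProfiniteOuterIsoLifts X₁ X₁` all FAIL at `X₁`, and `X₁` violates the tower input `htower₀` of the
cell's closers (by `piTempNormallyTerminal_of_tower`).  Not a curve; nothing in print is refuted.
[cite: MochizukiSemiAnbd2006, §6 pp.69-72] -/
theorem exists_temperedCurve_isTempered_not_piTempNormallyTerminal :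
    ∃ X : TemperedCurve p, IsTempered X.PiTemp ∧
      X.toHat.toMonoidHom.range.Normal ∧ X.toHat.toMonoidHom.range ≠ ⊤ ∧
      ¬ X.PiTempNormallyTerminal ∧ ¬ X.PiTempDenseDOFConjugator ∧ ¬ X.OpenDenseDOFConjugator ∧
      ¬ X.ProfiniteOuterIsoLifts X ∧
      ¬ (∀ U ∈ 𝓝 (1 : X.PiTemp), ∃ N : OpenNormalSubgroup X.PiTemp, (N : Set X.PiTemp) ⊆ U ∧
          ∃ (G : Subgroup (X.PiTemp ⧸ N.toSubgroup)) (_ : IsFreeGroup G), G.Normal ∧ G.FiniteIndex ∧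
            Finite (IsFreeGroup.Generators G) ∧ ∃ a ∈ G, ∃ b ∈ G, a * b ≠ b * a) := by
  haveI : IsGalois ℚ_[p] (AlgebraicClosure ℚ_[p]) := {}
  haveI : T2Space (GQp p) := krullTopology_t2
  haveI : Countable (Multiplicative ℤ) := inferInstanceAs (Countable ℤ)
  -- `η : ℤ → Ẑ`, Mathlib's profinite completion, as a continuous homomorphism from the discrete `ℤ`
  let η : Multiplicative ℤ →ₜ* completion (GrpCat.of (Multiplicative ℤ)) :=
    { toMonoidHom := toProfiniteCompletion (Multiplicative ℤ)
      continuous_toFun := continuous_of_discreteTopology }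
  have hη : IsProfiniteCompletion η := isProfiniteCompletion_toProfiniteCompletion (Multiplicative ℤ)
  have hηeta : ∀ k : Multiplicative ℤ, η k = etaFn (GrpCat.of (Multiplicative ℤ)) k := fun _ => rfl
  have hηinj : Function.Injective η := fun a b hab =>
    etaFn_int_injective (by rw [← hηeta, ← hηeta]; exact hab)
  obtain ⟨α, hα⟩ := exists_continuousMulEquiv_etaFn_one_not_mem_range
  -- the moved element `z₀ := α (η 1) ∉ η(ℤ)`
  have hz₀η : ∀ k : Multiplicative ℤ,
      η k ≠ α (η (Multiplicative.ofAdd (1 : ℤ) : Multiplicative ℤ)) := fun k hk =>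
    hα ⟨k, by rw [← hηeta, hk, hηeta]⟩
  let X : TemperedCurve p :=
    { K := ⊥
      finiteDimensional_K := inferInstance
      PiTemp := Multiplicative ℤ × GQp p
      aug := ContinuousMonoidHom.snd (Multiplicative ℤ) (GQp p)
      range_aug := by
        rw [IntermediateField.fixingSubgroup_bot]
        exact MonoidHom.range_eq_top.mpr Prod.snd_surjective
      PiHat := completion (GrpCat.of (Multiplicative ℤ)) × GQp p
      toHat := η.prodMap (ContinuousMonoidHom.id (GQp p))
      isProfiniteCompletion_toHat := hη.prodMap_id
      toHat_injective := hηinj.prodMap Function.injective_id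
      augHat := ContinuousMonoidHom.snd _ (GQp p)
      augHat_comp := fun _ => rfl
      Pt := PEmpty
      IsCusp := fun x => x.elim
      decomp := fun x => x.elim
      isClosed_decomp := fun x => x.elim
      isOpen_aug_decomp := fun x => x.elim
      inertia_eq_bot := fun x => x.elim
      inertia_equiv_zHat := fun x => x.elim }
  have htoHat : ∀ y : X.PiTemp, X.toHat y = (η y.1, y.2) := fun _ => rfl
  -- membership in the image of `Π^temp`: first coordinate in `η(ℤ)`
  have hmem : ∀ x : X.PiHat, x ∈ X.toHat.toMonoidHom.range ↔ ∃ k : Multiplicative ℤ, η k = x.1 := by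
    intro x
    constructor
    · rintro ⟨y, hy⟩
      exact ⟨y.1, congrArg Prod.fst hy⟩
    · rintro ⟨k, hk⟩
      refine ⟨(k, x.2), ?_⟩
      change (η k, x.2) = x
      exact Prod.ext hk rfl
  -- the image is normal (`Ẑ` is commutative)
  have hnormal : X.toHat.toMonoidHom.range.Normal := by
    refine ⟨fun y hy c => ?_⟩
    obtain ⟨k, hk⟩ := (hmem y).mp hy
    refine (hmem _).mpr ⟨k, ?_⟩
    rw [Prod.fst_mul, Prod.fst_mul, Prod.fst_inv, ← hk,
      Literature.AnabelianGeometry.AbsoluteAnabelian.ZHatCompletion.mul_comm c.1 (η k),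
      mul_inv_cancel_right]
  -- and proper: `(z₀, 1)` is outside
  have hout : ((α (η (Multiplicative.ofAdd (1 : ℤ) : Multiplicative ℤ)), 1) : X.PiHat) ∉
      X.toHat.toMonoidHom.range := fun h => by
    obtain ⟨k, hk⟩ := (hmem _).mp h
    exact hz₀η k hk
  have hne : X.toHat.toMonoidHom.range ≠ ⊤ := fun h => hout (h ▸ Subgroup.mem_top _)
  -- the full group `⊤ ≤ Π^temp` is open of finite index, of DOF-type, with dense image
  have htopopen : IsOpen ((⊤ : Subgroup X.PiTemp) : Set X.PiTemp) := by
    rw [Subgroup.coe_top]; exact isOpen_univ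
  have hDOF : IsDOFType (⊤ : Subgroup X.PiTemp) :=
    ⟨⊤, htopopen, inferInstance, by rw [Subgroup.coe_top, closure_univ]⟩
  have hdense : Dense (X.toHat '' ((⊤ : Subgroup X.PiTemp) : Set X.PiTemp)) := by
    rw [Subgroup.coe_top, Set.image_univ]
    exact X.isProfiniteCompletion_toHat.denseRange
  have hmaptop : (⊤ : Subgroup X.PiTemp).map X.toHat.toMonoidHom = X.toHat.toMonoidHom.range :=
    (MonoidHom.range_eq_map _).symm
  have hT : IsTempered X.PiTemp := isTempered_of_discreteTopology.prod_of_profinite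
  -- Lemma 6.1 (iii) fails
  have h61 : ¬ X.PiTempNormallyTerminal := by
    intro h
    haveI := hnormal
    have h' : Subgroup.normalizer (X.toHat.toMonoidHom.range : Set X.PiHat) = ⊤ :=
      Subgroup.normalizer_eq_top _
    exact hne (h.symm.trans h')
  refine ⟨X, hT, hnormal, hne, h61, ?_, ?_, ?_,
    fun htower => h61 (X.piTempNormallyTerminal_of_tower hT htower)⟩
  · -- Lemma 6.3 (iii) fails: `F₁ = F₂ = Π^temp`, `f = (z₀, 1)`
    intro h
    have := h ⊤ ⊤ hDOF hDOF hdense hdense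
      (ConjAct.toConjAct
        ((α (η (Multiplicative.ofAdd (1 : ℤ) : Multiplicative ℤ)), 1) : X.PiHat))
      (by rw [hmaptop]; exact hnormal.conjAct _)
    rw [ConjAct.ofConjAct_toConjAct] at this
    exact hout this
  · -- T64-L06′ fails: `U = F₁ = F₂ = Π^temp`, `c = (z₀, 1)`
    intro h
    have hc : ((α (η (Multiplicative.ofAdd (1 : ℤ) : Multiplicative ℤ)), 1) : X.PiHat) ∈
        closure (X.toHat '' ((⊤ : Subgroup X.PiTemp) : Set X.PiTemp)) := by
      rw [hdense.closure_eq]; exact Set.mem_univ _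
    have := h ⊤ htopopen inferInstance ⊤ ⊤ le_rfl le_rfl hDOF hDOF rfl rfl _ hc
      (by rw [hmaptop]; exact hnormal.conjAct _)
    rw [Subgroup.coe_top, Set.image_univ] at this
    obtain ⟨y, hy⟩ := this
    exact hout (MonoidHom.mem_range.mpr ⟨y, hy⟩)
  · -- Theorem 6.6 fails: `α × id` lies under no automorphism of `Π^temp`
    intro h
    let αhat : X.PiHat ≃ₜ* X.PiHat :=
      ContinuousMulEquiv.mk' (α.toHomeomorph.prodCongr (Homeomorph.refl (GQp p)))
        (fun x y => Prod.ext (map_mul α x.1 y.1) rfl)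
    have hαhat : ∀ x : X.PiHat, αhat x = (α x.1, x.2) := fun _ => rfl
    obtain ⟨⟨β, c, hβ⟩, -⟩ := h αhat
    have h1 := hβ ((Multiplicative.ofAdd (1 : ℤ) : Multiplicative ℤ), 1)
    rw [htoHat, hαhat, htoHat] at h1
    have h1' := congrArg Prod.fst h1
    rw [Prod.fst_mul, Prod.fst_mul, Prod.fst_inv,
      Literature.AnabelianGeometry.AbsoluteAnabelian.ZHatCompletion.mul_comm c.1 _,
      mul_inv_cancel_right] at h1'
    -- `h1' : α (η 1) = η (β (1, 1)).1`
    exact hz₀η _ h1'.symm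

/-- **`IsTempered` alone does not give the typed [SemiAnbd] Lemma 6.1 (iii)** over the interface: the
tower binder `htower₀` of `piTempNormallyTerminal_of_tower` is not idle.
[cite: MochizukiSemiAnbd2006, Lem 6.1(iii) p.69] -/
theorem not_forall_isTempered_piTempNormallyTerminal :
    ¬ ∀ X : TemperedCurve p, IsTempered X.PiTemp → X.PiTempNormallyTerminal := by
  intro h
  obtain ⟨X, hT, -, -, h61, -⟩ := exists_temperedCurve_isTempered_not_piTempNormallyTerminal p
  exact h61 (h X hT)

/-- **F-2837 is datum-guarded by necessity**: the closed form `∀ Y, Y.OpenDenseDOFConjugator` of the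
sub-node T64-L06′ ([SemiAnbd] Lem. 6.3 (iii) for open subgroups of finite index) is FALSE over the
interface (true for every `Y` with the tower: `openDenseDOFConjugator_of_tower`).
[cite: MochizukiSemiAnbd2006, Lem 6.3(iii) p.70] -/
theorem not_forall_openDenseDOFConjugator :
    ¬ ∀ Y : TemperedCurve p, Y.OpenDenseDOFConjugator := by
  intro h
  obtain ⟨X, -, -, -, -, -, h64, -⟩ := exists_temperedCurve_isTempered_not_piTempNormallyTerminal p
  exact h64 (h X)

/-- **F-1706 is origin-guarded by necessity**: for the origin certificate "every datum is a curve" the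
printed [SemiAnbd] Lemma 6.1 (ii)(iii) statement `ProfiniteNormalizersHolds` fails, so the closed form
`∀ Ω, Ω.ProfiniteNormalizersHolds` is false — the row is a hypothesis ON `Ω` (dischargeable at any
origin whose certified data are tempered with the tower), never a closed fact.
[cite: MochizukiSemiAnbd2006, Lem 6.1(ii)-(iii) p.69] -/
theorem not_forall_profiniteNormalizersHolds :
    ¬ ∀ Ω : TemperedOrigin p, Ω.ProfiniteNormalizersHolds := by
  intro h
  obtain ⟨X, -, -, -, h61, -⟩ := exists_temperedCurve_isTempered_not_piTempNormallyTerminal p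
  exact h61 ((h ⟨fun _ => True⟩) X trivial).2

/-- **F-1705 is origin-guarded by necessity**: the closed form `∀ Ω, Ω.DenseSubgroupsHolds` of the
printed [SemiAnbd] Lemma 6.3 (ii)(iii) statement is false over the interface (its third conjunct
`PiTempDenseDOFConjugator` fails at `X₁`; dischargeable at any origin with the tower:
`denseSubgroupsHolds_of_tower`). [cite: MochizukiSemiAnbd2006, Lem 6.3(ii)-(iii) p.70] -/
theorem not_forall_denseSubgroupsHolds :
    ¬ ∀ Ω : TemperedOrigin p, Ω.DenseSubgroupsHolds := by
  intro h
  obtain ⟨X, -, -, -, -, h63, -⟩ := exists_temperedCurve_isTempered_not_piTempNormallyTerminal p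
  exact h63 ((h ⟨fun _ => True⟩) X trivial).2.2.1

/-- **F-1707 is origin-guarded by necessity**: the closed form `∀ Ω, Ω.ProfiniteOuterIsoLiftsHolds` of
the printed [SemiAnbd] Theorem 6.6 statement is false over the interface (at `X₁` the automorphism
`α × id` of `Π = Ẑ × G_{ℚ_p}` lies under no automorphism of `Π^temp = ℤ × G_{ℚ_p}`; dischargeable at
any origin with the tower and the specialisation systems: `profiniteOuterIsoLiftsHolds_of_tower`).
[cite: MochizukiSemiAnbd2006, Thm 6.6 p.72] -/
theorem not_forall_profiniteOuterIsoLiftsHolds :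
    ¬ ∀ Ω : TemperedOrigin p, Ω.ProfiniteOuterIsoLiftsHolds := by
  intro h
  obtain ⟨X, -, -, -, -, -, -, h66, -⟩ := exists_temperedCurve_isTempered_not_piTempNormallyTerminal p
  exact h66 ((h ⟨fun _ => True⟩) X X trivial trivial)

end Curve

end Literature.AnabelianGeometry.SemiGraphs

end
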